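import Literature.IUT.HodgeArakelov.ThetaInftyAssembly
import Literature.IUT.HodgeArakelov.EtaleThetaDataOfSettingCofinal

/-!
# [IUTchII] Prop 1.4 / Prop 2.2 (ii) at the model: finite-index open LEVELS `J ≤ Π` from finite Galois coverings
# of `Ÿ̲̲` that are Galois over `X̲̲` (the «`J` ranges over the finite index open subgroups of `Π`» mechanism)

Proof-only companion (abc-iut cell, D-0067 wave 4, cone of [IUTchIII] Cor. 3.12; DAG node **IUTchII:Prop2.2(ii)**,
«respectively» clause; no definitions, no `Prop`-valued facts; seat abc-iut-w4-d010 gen 2). S. Mochizuki,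
*Inter-universal Teichmüller theory II*, kurims manuscript (Dec. 2020), Prop. 1.4 p. 27: «`lim_J H¹(Π_Ÿ(Π)∣_J,
(l·Δ_Θ)(Π))` … where `J` ranges over the finite index open subgroups of `Π`» (claim key `Mochizuki2012`, DISPUTED,
D-0012); [EtTh] (S. Mochizuki, Publ. RIMS **45** (2009), refereed) §1 pp. 13–14, 17, 20 (the coverings `Y_N`, `Z_N`,
`Ÿ_N`, `Z̈_N` of `Y`, Galois over `X`: «`Π^tp_X/Π^tp_{Z_N} = Gal(Z_N/X)`», Prop. 1.1 (ii); the `N`-th roots of `Θ̈` live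
on `Z̈_N`).

WHY. `Π_Ÿ(Π) = Π^tp_Ÿ̲̲` has INFINITE index in `Π = Π^tp_X̲̲` (`Π^tp_X̲̲/Π^tp_Ÿ̲̲ ≅ (l·ℤ) × μ₂`), so a finite covering of `Ÿ̲̲`
(an open subgroup `N ≤ Π^tp_Ÿ̲̲` of finite index) is cut out by a FINITE-INDEX open `J ≤ Π` (`Π^tp_Ÿ̲̲ ∩ J ⊆ N`) only
when it descends along the `ℤ`-direction; for `N` NORMAL IN `Π` (a covering of `Ÿ̲̲` Galois over `X̲̲`, as the printed
`Z̈_N` are) the subgroup `J := N · γ^ℤ` (`γ` a generator of `Π/Π^tp_Y̲̲ ≅ ℤ`) does it: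
* this is abc-iut-w5-d187's COFINALITY lemma `exists_finiteIndex_open_inf_eq` (`EtaleThetaDataOfSettingCofinal.lean`,
  p419144; consumed BY NAME, nothing restated): for `N ⊴ Π` open with `N ≤ Π_Ÿ(Π)` of finite index in `Π_Ÿ(Π)`,
  there is a finite-index open `J ≤ Π` with `Π_Ÿ(Π) ∩ J = N`;
* `exists_level_fixing_of_normal` — hence the finite-level definability hypothesis `hJ` of this seat's
  `hdivTorsion_etaleThetaDataOfSetting'` / `inftyClause_of_cyclotomeTower_thetaKummer` (p419496 / p419977) FOLLOWS
  from its GALOIS form «the root `Θ̈^{1/M}` is fixed by an open `N ⊴ Π^tp_X̲̲`, `N ≤ Π^tp_Ÿ̲̲` of finite index» (print: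
  `Θ̈^{1/M}` is a function on `Z̈_M`, and `Π^tp_{Z̈_M} ⊴ Π^tp_X` is open of finite index in `Π^tp_Ÿ`);
* `inftyClause_of_cyclotomeTower_thetaKummer_galois` — the «respectively» clause at the model with `hJ` in that
  Galois form.
HONEST FRAMING: the Galois-form hypothesis is still a hypothesis on abc-iut-L2-t12's `ThetaKummerInput` data
(`Fn` has no carrier); `[Π^tp_Ÿ̲̲ : Π^tp_{Z̈_M} ∩ Π^tp_X̲̲] < ∞` is the classical finiteness `[J̈_M : K̈] < ∞` of local
Kummer theory, not derivable from `Setting.lean`. Nothing here takes a side on [IUTchIII] Cor. 3.12; typed ≠ proved.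
-/

namespace Literature.IUT.HodgeArakelov

open Literature.AnabelianGeometry.EtaleTheta
open EtaleThetaDataOfSetting

noncomputable section

namespace EtaleThetaDataOfSetting

variable {p : ℕ} [Fact p.Prime] {D : Literature.AnabelianGeometry.EtaleTheta.ThetaSetting p}
  {E : D.EtaleThetaData} {l : ℕ} (C : E.DoubleUnderline l)

/-! ### §1. Finite-level definability from its Galois form (via abc-iut-w5-d187's cofinality lemma) -/

/-- **Finite-level definability from its Galois form.** If `f` is fixed by an open `N ⊴ Π`, `N ≤ Π_Ÿ(Π)` of finite
index in `Π_Ÿ(Π)` (print: `f` is a function on a finite covering `Z̈_M` of `Ÿ̲̲`, Galois over `X̲̲`), then `f` is fixed by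
`Π_Ÿ(Π) ∩ J` for some finite-index open `J ≤ Π` — the hypothesis `hJ` of `hdivTorsion_etaleThetaDataOfSetting'`.
[cite: MochizukiEtTh2009, §1 p.20] -/
theorem exists_level_fixing_of_normal (hS : D.Sec2Hyps) {F : Type} [MulAction D.PiTemp F]
    (f : F) (h : ∃ N : Subgroup (Pi C), N.Normal ∧ N ≤ PiYdd C ∧ IsOpen (N : Set (Pi C)) ∧
      (N.subgroupOf (PiYdd C)).FiniteIndex ∧ ∀ g : Pi C, g ∈ N → (g : D.PiTemp) • f = f) :
    ∃ J : Subgroup (Pi C), J.FiniteIndex ∧ IsOpen (J : Set (Pi C)) ∧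
      ∀ g : Pi C, g ∈ PiYdd C ⊓ J → (g : D.PiTemp) • f = f := by
  obtain ⟨N, hNn, hNle, hNo, hfin, hfix⟩ := h
  haveI := hNn
  obtain ⟨J, hJf, hJo, hJN⟩ := exists_finiteIndex_open_inf_eq C hS N hNle hNo hfin
  exact ⟨J, hJf, hJo, fun g hg => hfix g (hJN.le hg)⟩

/-! ### §2. The «respectively» clause with `hJ` in Galois form -/

/-- **IUTchII:Prop2.2(ii) «respectively» clause IN FULL at the model, Galois form of the level hypothesis**: as
`inftyClause_of_cyclotomeTower_thetaKummer` (p419977), with `hJ` replaced by «every root `Θ̈^{1/M}` of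
`T.thetaRoots` is fixed by an open `N_M ⊴ Π^tp_X̲̲`, `N_M ≤ Π^tp_Ÿ̲̲` of finite index in `Π^tp_Ÿ̲̲`» ([EtTh] §1 p. 20:
`Θ̈^{1/M}` lives on `Z̈_M`; `Π^tp_{Z̈_M} ⊴ Π^tp_X`, Prop. 1.1 (ii)). [claim: Mochizuki2012, status: disputed]
(IUTchII §2 Prop 2.2 (ii), kurims p.66) -/
theorem inftyClause_of_cyclotomeTower_thetaKummer_galois [hN : (PiYdd C).Normal] [hYN : D.GtpYdd.Normal]
    {Es : Set ℕ+} (hO : D.IsEtThOrigin) (τ : D.CyclotomeTower l Es)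
    (hC : D.Compat) (hS : D.Sec2Hyps) (hchar : PiYddCharacteristic C) (S : BadPlaceSetting.{0})
    (eS : (Pi C) ≃ₜ* S.PiX) (hl : S.l = l) {T₀ : TemperedCoverings S (Pi C)}
    {Dec : SubgraphDecomposition S T₀ (etaleThetaDataOfSetting' C hC hS hchar S.toThetaSetting eS hl)}
    (Θ : IotaInvariantTheta' Dec) (T : D.ThetaKummerInput) (hη : E.etaDd = T.kummerTheta)
    (hZdd : ∀ M : ℕ+, ∃ N : Subgroup (Pi C), N.Normal ∧ N ≤ PiYdd C ∧ IsOpen (N : Set (Pi C)) ∧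
      (N.subgroupOf (PiYdd C)).FiniteIndex ∧ ∀ g : Pi C, g ∈ N → (g : D.PiTemp) • T.thetaRoots.root M = T.thetaRoots.root M) :
    Θ.InftyClause :=
  inftyClause_of_cyclotomeTower_thetaKummer C hO τ hC hS hchar S eS hl Θ T hη
    fun M => exists_level_fixing_of_normal C hS _ (hZdd M)

end EtaleThetaDataOfSetting

end

end Literature.IUT.HodgeArakelov
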